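import Mathlib
import Summits.ABC.ABC.Theses.TwistAmplification
import Literature.NumberTheory.CubicFields.BinaryCubicForms

/-!
# Sketch — crux-ideate stmt-ABC-1975 (SharpModerateLaw), ideator 2, round 1

First lemmas / transfer statements for the three idea cards
`Ideas/deep-moduli-cusp-dispersion.md`, `Ideas/two-division-index-form.md`,
`Ideas/three-descent-quadratic-roots.md`.  Everything here elaborates; identities are proved by
`ring`, the rest are `Prop`s (statements only, as the crux-ideate protocol asks).
-/

namespace Summit.ABC.ABC.Cruxes.SharpModerateLaw.Ideator2

open scoped BigOperators

/-! ## Common transfer target C⁺ (card 1, used by all three): the elementary cusp-count law -/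

/-- Tower-freeness: the divisibility pattern that a model minimal at every prime cannot have
(p ≥ 5: `p⁴ ∣ c₄ ∧ p⁶ ∣ c₆`; at 2: `2⁸ ∣ c₄ ∧ 2¹¹ ∣ c₆`; at 3: `3⁵ ∣ c₄ ∧ 3⁹ ∣ c₆`), each excluded by
rescaling the short model `y² = x³ − 27c₄x − 54c₆` (Δ' = 6¹²Δ/λ¹²). -/
def TF (x : ℤ × ℤ) : Prop :=
  (∀ p : ℕ, p.Prime → 5 ≤ p → ¬ ((p : ℤ) ^ 4 ∣ x.1 ∧ (p : ℤ) ^ 6 ∣ x.2)) ∧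
  ¬ ((2 : ℤ) ^ 8 ∣ x.1 ∧ (2 : ℤ) ^ 11 ∣ x.2) ∧ ¬ ((3 : ℤ) ^ 5 ∣ x.1 ∧ (3 : ℤ) ^ 9 ∣ x.2)

/-- Conductor proxy `N*(c₄,c₆) = ∏_{p ∣ Δ} (p if p ∤ c₄, p² if p ∣ c₄)`, `Δ = (c₄³ − c₆²)/1728`;
for a minimal model `N* ≤ N` (multiplicative ⇔ `p ∣ Δ, p ∤ c₄` gives exponent 1; additive ≥ 2). -/
def Nstar (x : ℤ × ℤ) : ℕ :=
  ∏ p ∈ ((x.1 ^ 3 - x.2 ^ 2) / 1728).natAbs.primeFactors, (if ((p : ℕ) : ℤ) ∣ x.1 then p ^ 2 else p)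

/-- The counted set of C⁺ at scales `(X, Y)`: integer pairs `(u,v) = (c₄,c₆)`, `uv ≠ 0`, `u³ ≠ v²`,
`1728 ∣ u³ − v²`, tower-free, with `M⁺ := max(|u|³, |Δ|) ≲ Y` and `N* ≤ X`. -/
def cuspSet (X Y : ℝ) : Set (ℤ × ℤ) :=
  {x | x.1 ≠ 0 ∧ x.2 ≠ 0 ∧ x.1 ^ 3 ≠ x.2 ^ 2 ∧ (1728 : ℤ) ∣ x.1 ^ 3 - x.2 ^ 2 ∧ TF x ∧
    ((|x.1| ^ 3 : ℤ) : ℝ) ≤ Y ∧ ((|x.1 ^ 3 - x.2 ^ 2| : ℤ) : ℝ) ≤ 1728 * Y ∧ (Nstar x : ℝ) ≤ X}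

/-- **C⁺ = CuspCountLaw σ.** Two-parameter elementary law: for `1 ≤ Y ≤ X^σ`,
`#cuspSet(X,Y) ≤ C_ε X^ε (X · Y^{-1/6} + 1)`.  Twist-covariant, saturated by every
Davenport–Stothers-extremal family; the `+1` keeps it free of pointwise Szpiro content. -/
def CuspCountLaw (σ : ℝ) : Prop :=
  ∀ ε : ℝ, 0 < ε → ∃ C : ℝ, ∀ X Y : ℝ, 1 ≤ X → 1 ≤ Y → Y ≤ X ^ σ →
    (Set.ncard (cuspSet X Y) : ℝ) ≤ C * X ^ ε * (X * Y ^ (-(1 / 6 : ℝ)) + 1)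

/-- **Transfer (stub shape for crux-plan):** C⁺ for every σ > 6 implies the crux, by dyadic
decomposition in `N` and `M⁺`, the injection reduced-minimal-model ↦ (c₄,c₆) (≤ 12 to 1),
`N* ≤ conductorNorm`, and tower-freeness of minimal models. -/
def Transfer : Prop :=
  (∀ σ : ℝ, 6 < σ → CuspCountLaw σ) → Summit.ABC.ABC.Theses.TwistAmplification.SharpModerateLaw

/-! ## Card 1 — deep-moduli cusp dispersion: entry lemma (cusp parametrisation) -/

/-- For `D ∣ u³ − v²` with `gcd(u, D) = 1` the pair `(u,v)` lies on the parametrised cuspidal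
cubic mod `D`: `u ≡ t², v ≡ t³` with `t = v·u⁻¹`.  (Tate: `E₄ ≡ 1, E₆ ≡ 1 mod q`.) -/
def CuspParam : Prop :=
  ∀ u v D : ℤ, IsCoprime u D → D ∣ u ^ 3 - v ^ 2 → ∃ t : ℤ, t ^ 2 ≡ u [ZMOD D] ∧ t ^ 3 ≡ v [ZMOD D]

theorem cuspParam_holds : CuspParam := by
  intro u v D hcop hdvd
  obtain ⟨a, b, hab⟩ := hcop
  have h' : D ∣ v ^ 2 - u ^ 3 := by
    rw [show v ^ 2 - u ^ 3 = -(u ^ 3 - v ^ 2) by ring]; exact dvd_neg.mpr hdvd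
  refine ⟨v * a, ?_, ?_⟩
  · have h1 : (v * a) ^ 2 - u = (v ^ 2 - u ^ 3) * a ^ 2 - u * b * D * (u * a + 1) := by
      linear_combination (u * (u * a + 1)) * hab
    refine (Int.modEq_iff_dvd.mpr ?_).symm
    rw [h1]
    exact dvd_sub (h'.mul_right _) ⟨u * b * (u * a + 1), by ring⟩
  · have h2 : (v * a) ^ 3 - v
        = (v ^ 2 - u ^ 3) * v * a ^ 3 - v * b * D * ((u * a) ^ 2 + u * a + 1) := by
      linear_combination (v * ((u * a) ^ 2 + u * a + 1)) * hab
    refine (Int.modEq_iff_dvd.mpr ?_).symm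
    rw [h2]
    exact dvd_sub ((h'.mul_right _).mul_right _) ⟨v * b * ((u * a) ^ 2 + u * a + 1), by ring⟩

/-- The complete sum along the cusp to a deep modulus is a single stationary phase: the critical
point of `f(t) = h₁t² + h₂t³` on units is `t₀ = −2h₁/(3h₂)` with `f(t₀) = 4h₁³/(27h₂²)`,
`f''(t₀) = −2h₁`.  Recorded as the polynomial identities behind it. -/
theorem cusp_stationary_phase (h₁ h₂ t₀ : ℚ) (h : 3 * h₂ * t₀ = -2 * h₁) :
    h₁ * t₀ ^ 2 + h₂ * t₀ ^ 3 = h₁ * t₀ ^ 2 / 3 ∧ 2 * h₁ + 6 * h₂ * t₀ = -2 * h₁ := by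
  constructor
  · linear_combination (t₀ ^ 2 / 3) * h
  · linear_combination 2 * h

/-- **Card 1 analytic core (informal Prop shape): deep-moduli level of distribution.**
For `1 ≤ R ≤ X`, moduli `e` powerful with `rad e ≤ X/R`, `e ∈ (E, 2E]`, `E ≍ Y/R`:
`Σ_e |#{(u,v) ∈ Box(Y) : gcd(u,e)=1, e ∣ u³−v²} − φ(e)·|Box(Y)|/e²·e| ≤ C_ε X^ε · X·Y^{-1/6}`.
Stated here over an explicit finite range so that it elaborates. -/
def DeepModuliLevel : Prop :=
  ∀ ε : ℝ, 0 < ε → ∃ C : ℝ, ∀ X Y R E : ℝ, 1 ≤ R → R ≤ X → 1 ≤ Y → 1 ≤ E →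
    (∑ e ∈ (Finset.Icc 1 (Nat.ceil (2 * E))).filter
        (fun e : ℕ => E < (e : ℝ) ∧ (∀ p ∈ e.primeFactors, p ^ 2 ∣ e) ∧
          ((∏ p ∈ e.primeFactors, p : ℕ) : ℝ) * R ≤ X),
      |(Set.ncard {x : ℤ × ℤ | |x.1| ^ 3 ≤ (Nat.floor Y : ℤ) ∧ x.2 ^ 2 ≤ 4 * (Nat.floor Y : ℤ) ∧
            Int.gcd x.1 (e : ℤ) = 1 ∧ (e : ℤ) ∣ x.1 ^ 3 - x.2 ^ 2} : ℝ)
        - (Nat.totient e : ℝ) * (2 * Y ^ (1 / 3 : ℝ)) * (4 * Y ^ (1 / 2 : ℝ)) / (e : ℝ) ^ 2|)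
      ≤ C * X ^ ε * (X * Y ^ (-(1 / 6 : ℝ)) + 1)

/-! ## Card 2 — 2-division index form: node lemma and the covariant syzygy -/

/-- Node lemma: on the cusp congruence the 2-division cubic `x³ − 27c₄x − 54c₆` acquires a
DOUBLE root `−3t` and a simple root `6t` (deep multiplicative prime = deep 2-torsion coincidence). -/
theorem two_division_node (t x : ℤ) :
    x ^ 3 - 27 * t ^ 2 * x - 54 * t ^ 3 = (x + 3 * t) ^ 2 * (x - 6 * t) := by ring

theorem two_division_node_mod (u v t D x : ℤ) (hu : u ≡ t ^ 2 [ZMOD D]) (hv : v ≡ t ^ 3 [ZMOD D]) :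
    x ^ 3 - 27 * u * x - 54 * v ≡ (x + 3 * t) ^ 2 * (x - 6 * t) [ZMOD D] := by
  rw [← two_division_node]
  have h1 : 27 * u * x ≡ 27 * t ^ 2 * x [ZMOD D] := (hu.mul_left 27).mul_right x
  have h2 : 54 * v ≡ 54 * t ^ 3 [ZMOD D] := hv.mul_left 54
  exact ((Int.ModEq.refl _).sub h1).sub h2

/-- **Hensel step along the cusp (card 2's first lemma).** If `(c₄, c₆)` is on the cusp modulo
`a²` with parameter `t`, and `t₀ ≡ t (mod a)` is the parameter modulo `a`, then `c₆` is determined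
modulo `a²` by a LINEAR expression in `c₄`: `2c₆ ≡ 3t₀c₄ − t₀³ (mod a²)`.  (Key identity:
`2t³ − 3t₀t² + t₀³ = (t − t₀)²(2t + t₀)`.)  So the quadratic condition lives modulo `a = √(a²)`
and the cubic one becomes a single incomplete condition modulo `a²`. -/
theorem hensel_cusp (c₄ c₆ a t t₀ : ℤ) (hdiv : a ∣ t - t₀)
    (hc₄ : t ^ 2 ≡ c₄ [ZMOD a ^ 2]) (hc₆ : t ^ 3 ≡ c₆ [ZMOD a ^ 2]) :
    2 * c₆ ≡ 3 * t₀ * c₄ - t₀ ^ 3 [ZMOD a ^ 2] := by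
  have h0 : (t - t₀) ^ 2 * (2 * t + t₀) ≡ 0 [ZMOD a ^ 2] :=
    Int.modEq_zero_iff_dvd.mpr (dvd_mul_of_dvd_left (pow_dvd_pow_of_dvd hdiv 2) _)
  calc 2 * c₆ ≡ 2 * t ^ 3 [ZMOD a ^ 2] := (hc₆.mul_left 2).symm
    _ = (3 * t₀ * t ^ 2 - t₀ ^ 3) + (t - t₀) ^ 2 * (2 * t + t₀) := by ring
    _ ≡ (3 * t₀ * t ^ 2 - t₀ ^ 3) + 0 [ZMOD a ^ 2] := h0.add_left _
    _ = 3 * t₀ * t ^ 2 - t₀ ^ 3 := by ring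
    _ ≡ 3 * t₀ * c₄ - t₀ ^ 3 [ZMOD a ^ 2] := (hc₄.mul_left (3 * t₀)).sub_right _

/-- Discriminant of the 2-division cubic: `disc(x³ − 27c₄x − 54c₆) = 2²·3⁹·(c₄³ − c₆²)`. -/
theorem two_division_disc (c₄ c₆ : ℤ) :
    Cubic.discr ⟨1, 0, -27 * c₄, -54 * c₆⟩ = 2 ^ 2 * 3 ^ 9 * (c₄ ^ 3 - c₆ ^ 2) := by
  simp only [Cubic.discr]; ring

/-- The classical syzygy of a binary cubic form `f = (a,b,c,d)`: with `H(1,0) = b² − 3ac`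
(Hessian) and `G(1,0) = 2b³ − 9abc + 27a²d` (cubic covariant), `4H³ − G² = 27·a²·Disc f`.
Reading: `c₄ ∝ H`, `c₆ ∝ G`, so `Δ_E ∝ a² · Disc(f)` — large Szpiro ratio = small `Disc f` and a
huge, radically small leading coefficient `a` (the index of `ℤ[ξ]` in the marked cubic ring). -/
theorem cubic_covariant_syzygy (a b c d : ℤ) :
    4 * (b ^ 2 - 3 * a * c) ^ 3 - (2 * b ^ 3 - 9 * a * b * c + 27 * a ^ 2 * d) ^ 2
      = 27 * a ^ 2 * (b ^ 2 * c ^ 2 - 4 * a * c ^ 3 - 4 * b ^ 3 * d - 27 * a ^ 2 * d ^ 2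
          + 18 * a * b * c * d) := by
  ring

/-- The same syzygy against the tree's `Literature.NumberTheory.CubicFields.BinaryCubic.disc`
(BTT (7)): `4·H(1,0)³ − G(1,0)² = 27 a² · Disc f`. -/
theorem cubic_covariant_syzygy' (f : Literature.NumberTheory.CubicFields.BinaryCubic ℤ) :
    4 * (f.b ^ 2 - 3 * f.a * f.c) ^ 3 - (2 * f.b ^ 3 - 9 * f.a * f.b * f.c + 27 * f.a ^ 2 * f.d) ^ 2
      = 27 * f.a ^ 2 * f.disc := by
  rw [Literature.NumberTheory.CubicFields.BinaryCubic.disc_eq]; ring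

/-- **Card 2 census shape (Prop):** marked binary cubic forms `(a,b,c,d)` with `b` reduced mod `3a`,
small covariants at `(1,0)` and radically small discriminant data; the bound is C⁺'s right side.
(`|H| ≤ Y^{1/3}`, `|G| ≤ 2·Y^{1/2}`; `rad(a)·rad(Disc) ≤ X` as the conductor proxy.) -/
def IndexFormCensus (σ : ℝ) : Prop :=
  ∀ ε : ℝ, 0 < ε → ∃ C : ℝ, ∀ X Y : ℝ, 1 ≤ X → 1 ≤ Y → Y ≤ X ^ σ →
    (Set.ncard {f : ℤ × ℤ × ℤ × ℤ | 0 < f.1 ∧ 0 ≤ f.2.1 ∧ f.2.1 < 3 * f.1 ∧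
        ((|f.2.1 ^ 2 - 3 * f.1 * f.2.2.1| : ℤ) : ℝ) ≤ Y ^ (1 / 3 : ℝ) ∧
        ((|2 * f.2.1 ^ 3 - 9 * f.1 * f.2.1 * f.2.2.1 + 27 * f.1 ^ 2 * f.2.2.2| : ℤ) : ℝ)
          ≤ 2 * Y ^ (1 / 2 : ℝ) ∧
        f.2.1 ^ 2 * f.2.2.1 ^ 2 - 4 * f.1 * f.2.2.1 ^ 3 - 4 * f.2.1 ^ 3 * f.2.2.2
          - 27 * f.1 ^ 2 * f.2.2.2 ^ 2 + 18 * f.1 * f.2.1 * f.2.2.1 * f.2.2.2 ≠ 0 ∧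
        ((∏ p ∈ (f.1.natAbs * (f.2.1 ^ 2 * f.2.2.1 ^ 2 - 4 * f.1 * f.2.2.1 ^ 3
            - 4 * f.2.1 ^ 3 * f.2.2.2 - 27 * f.1 ^ 2 * f.2.2.2 ^ 2
            + 18 * f.1 * f.2.1 * f.2.2.1 * f.2.2.2).natAbs).primeFactors, p : ℕ) : ℝ) ≤ X}
      : ℝ) ≤ C * X ^ ε * (X * Y ^ (-(1 / 6 : ℝ)) + 1)

/-! ## Card 3 — 3-descent over the quadratic resolvent: Euler's identity and the descent Prop -/

/-- Euler: `N((m + n√−D)³) = N(m + n√−D)³`, i.e. the principal-class parametrisation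
`u = m² + Dn²`, `v = m³ − 3Dmn²`, `y = n(3m² − Dn²)` of `u³ = v² + D y²`. -/
theorem euler_cube_identity (D m n : ℤ) :
    (m ^ 2 + D * n ^ 2) ^ 3 = (m ^ 3 - 3 * D * m * n ^ 2) ^ 2 + D * (3 * m ^ 2 * n - D * n ^ 3) ^ 2 := by
  ring

/-- The reducible index form of the principal class: `y = n · (3m² − Dn²)`; the second factor is the
one-variable quadratic whose roots mod powerful `P` the census must locate. -/
theorem principal_class_factor (D m n : ℤ) :
    3 * m ^ 2 * n - D * n ^ 3 = n * (3 * m ^ 2 - D * n ^ 2) := by ring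

/-- **Card 3 descent Prop (converse direction, finite twist set):** for squarefree `D > 0` there are
a nonzero integer `c` and a finite set `S ⊂ ℤ[√−D]` (units × generators of `𝔞_c³·𝔡` over
representatives `𝔞_c` of `Cl(ℚ(√−D))[3]` and the finitely many 2-adic corrections `𝔡`), both
depending only on `D`, such that every solution of `u³ = v² + D y²` with `gcd(v, D y) = 1` satisfies
`c·(v + y√−D) = ρ·(m + n√−D)³` for some `ρ ∈ S`, `m n : ℤ` (`c = 8·∏ N(𝔞_c)³` works: it absorbs
half-integers and the denominators of `𝔞_c⁻¹`). -/
def ThreeDescent : Prop :=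
  ∀ D : ℤ, 0 < D → Squarefree D → ∃ (c : ℤ) (S : Finset (ℤ√(-D))), c ≠ 0 ∧
    ∀ u v y : ℤ, IsCoprime v (D * y) → u ^ 3 = v ^ 2 + D * y ^ 2 →
      ∃ ρ ∈ S, ∃ m n : ℤ, (c : ℤ√(-D)) * ⟨v, y⟩ = ρ * (⟨m, n⟩ : ℤ√(-D)) ^ 3

/-- **Card 3 census shape (principal class, Prop):** roots of `3x² ≡ c (mod P)` over POWERFUL
moduli `P` rarely fall in the initial interval `[0, M)` when `P > M`: the count over
`P ∈ (P₀, 2P₀]` powerful and `c ∈ [1, Cmax]` is `≤ C_ε (P₀ Cmax)^ε (Cmax·√P₀·M/P₀ + "diagonal")`.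
Only the SHAPE is fixed here; the right side is what card 3 must supply. -/
def QuadRootCensus : Prop :=
  ∀ ε : ℝ, 0 < ε → ∃ C : ℝ, ∀ P₀ M Cmax : ℕ, 1 ≤ M → M ≤ P₀ → 1 ≤ Cmax →
    (Set.ncard {q : ℕ × ℕ × ℕ | P₀ < q.1 ∧ q.1 ≤ 2 * P₀ ∧ (∀ p ∈ q.1.primeFactors, p ^ 2 ∣ q.1) ∧
        1 ≤ q.2.1 ∧ q.2.1 ≤ Cmax ∧ q.2.2 < M ∧ (q.1 : ℤ) ∣ 3 * (q.2.2 : ℤ) ^ 2 - q.2.1} : ℝ)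
      ≤ C * ((P₀ : ℝ) * Cmax) ^ ε * ((Cmax : ℝ) * Real.sqrt P₀ * M / P₀ + (Cmax : ℝ) ^ (1 / 2 : ℝ) * M)

end Summit.ABC.ABC.Cruxes.SharpModerateLaw.Ideator2
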